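import Summits.HodgeConjecture.HodgeConjecture.Theorems.Ring2AbelianAllSpreadFrame
import HarnessLib

/-!
# Ring 2 · sub-cell AbelianAll · spread-1, part IV — the PER-CLASS BOTTOM of the Mumford–Tate-family branch:
# U_∃ `CMDenseFamilyCMSpreading`, next to which `HC_CM` is load-bearing and NO named fact is consumed
# (companion part V `Ring2AbelianAllSpreadEffective`: the effective and germ faces of row U are row U)

HONEST FRAMING (page 1, verbatim): **research route, not a corollary; conditional on HC_CM plus one named minimal
statement.** Cell line: research route conditional on HC_CM; not a corollary; Q11.4-sentence-2 already refuted in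
dim ≥ 3. Nothing below proves a case of the Hodge conjecture, `HC_CM` (`Theses.RankFourFaces.CMAbelianHodge`, item
stmt-HodgeConjecture-3052) is a BINDER `hCM` wherever it occurs, `HC_AV` = `Theses.PadicSemiregularLift.HodgeAbelianVarieties`
(stmt-HodgeConjecture-1333), and the reduction item `Theses.RankFourFaces.CMToAbelian` (stmt-HodgeConjecture-16267) stays
OPEN: every theorem toward it is a typed conditional. No statement minted in this cell is cited as a fact: the one new
node below is an `@[conjecture]` def used only as a hypothesis; Deligne's CM-dense Mumford–Tate families enter as the
literature seat's named fact `deligne1982_cmDenseMumfordTateFamilies` (binder `hF`, a THEOREM in print: LNM 900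
Prop. 6.1 = Charles–Schnell Thm. 11.5.11), André's Lemme 6.3.1 as `andre1996_cmAnchoredPencil` (binder `h₂₁`).
Seat `pub-hodge-ring2-ab-spread-1` (gen 2); parts I–III: `Ring2AbelianAllSpread` (S_ZD ⟹ U_Z ⟹ U, AO⁺, exactness),
`Ring2AbelianAllSpreadDomination` (S_ZD is CM-idle granted `DA_q`, `DA_K`), `Ring2AbelianAllSpreadFrame` (the rows in
the LEAD's grammar `ClosesWithCM` / `OnPathAV` / `ExactWithCM` / `CMIdle` / `ModCM` of `Ring2AbelianAllFrame`).

## §A The per-class bottom of the Mumford–Tate branch: U_∃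

Part II of the LEAD's frame (`Ring2AbelianAllFrameSpreading`) records the two branches of the candidate ladder below
(1) `AbelianSchemeVHC`: the PENCIL branch ends in deform XIII's per-class node CPS_∃ =
`Ring2.Deform.CMAnchoredPencilCMSpreading` ("for every Hodge class, SOME 6.3.1-pencil along which algebraicity spreads
out of ALL its CM fibres"), which closes with `HC_CM` and NO named fact; the MUMFORD–TATE branch ends in deform's
universal row U = `UniformAlgebraicityAtCMPoints`, which closes with `HC_CM` only modulo `hF`. This part types the
missing twin: **U_∃ = `CMDenseFamilyCMSpreading`** — for every complex abelian variety `A`, every `p` and every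
rational `(p,p)` class `c` on `A` there is SOME family `f : 𝒳 ⟶ S` which is a CM-dense Mumford–Tate family for
`(A, p, c)` in the printed sense (`Deligne1982.IsCMDenseMumfordTateFamilyFor A p c f`: the data (a)–(c) of
Thm. 11.5.11) along which algebraicity spreads from the CM fibres to every fibre (`Ring2.Deform.CMSpreadingTo f (dim A) s₁`
for all `s₁`, deform VII). Kernel facts (all by composition of landed theorems BY NAME; nothing of deform re-derived):

* `HC_CM ∧ U_∃ ⟹ HC_AV` with NO named fact (`HC_AV_of_HC_CM_and_cmDenseFamilyCMSpreading`; `hCM` is consumed at the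
  CM fibres only, through deform II-b's `forall_cmLocus_mem_algebraicClasses_of_HC_CM`), i.e. `ClosesWithCM U_∃`
  and `U_∃ ⟹ CMToAbelian` outright;
* `U ⟹[hF] U_∃`, `(∀ A, CMSpreadingAt A) ⟹[hF] U_∃`, `HC_AV ⟹[hF] U_∃` (on path), hence `ExactWithCM U_∃` and
  `ModCM U_∃ ↔ CMToAbelian` modulo `hF` — the same exactness bit as U, with the fact moved from the closing side to
  the on-path side;
* the two per-class bottoms CPS_∃ (pencils) and U_∃ (Mumford–Tate families) BOTH close fact-free; under `HC_CM` they
  are equivalent granted `h₂₁ ∧ hF` (both are `HC_AV`); WITHOUT `HC_CM` no edge between them is in the tree or claimed.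

So on the Mumford–Tate branch too the weakest sufficient complement of `HC_CM` consumes no fact: the brief's
`HC_AV_of_HC_CM_and_Bmin` is available with `B_min = U_∃` and EXACTLY two hypotheses. KIND (RING2-MAP §AbelianAll
R-rule "KIND by PREMISE"): U_∃'s premise is "algebraic at EVERY CM fibre", so it is of KIND 2 (complementary; on path;
not known CM-idle) like U and CPS_∃ — the Hecke-dense unconditional anchors that make S_ZD CM-idle (part II) do not
feed it.

References (bib keys): Deligne1982HodgeCycles (Prop. 6.1, Thm. 2.12); CharlesSchnell2014Notes (Thm. 11.5.11,
Prop. 11.3.11, Cor. 11.3.6, Conj. 11.3.1); Andre1996Motifs (Lemme 6.3.1, Remarque 2); VoisinHodgeII2003 (§3.3.1, §7.3.2);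
Voisin2007HodgeLoci (§0); Abdulali1994FamiliesAV (Lemma 6.2).
-/

set_option linter.dupNamespace false

noncomputable section

namespace Summit.HodgeConjecture.HodgeConjecture.Ring2.AbelianAll

open CategoryTheory AlgebraicGeometry
open Literature.AlgebraicGeometry Literature.AlgebraicGeometry.Motives
open Literature.AlgebraicGeometry.HodgeTheory
open Literature.AlgebraicGeometry.Andre1996 (andre1996_cmAnchoredPencil)
open Literature.AlgebraicGeometry.Deligne1982 (deligne1982_cmDenseMumfordTateFamilies IsCMDenseMumfordTateFamilyFor)
open Summit.HodgeConjecture.HodgeConjecture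
open Summit.HodgeConjecture.HodgeConjecture.Theses
open Summit.HodgeConjecture.HodgeConjecture.Theses.RankFourFaces (CMAbelianHodge CMToAbelian)
open Summit.HodgeConjecture.HodgeConjecture.Theses.PadicSemiregularLift (HodgeAbelianVarieties)
open Summit.HodgeConjecture.HodgeConjecture.Ring2.Deform (cmLocus UniformAlgebraicityAtCMPoints CMSpreadingTo
  CMSpreadingAt CMAnchoredPencilCMSpreading forall_cmLocus_mem_algebraicClasses_of_HC_CM
  cmSpreadingTo_of_uniformAlgebraicityOn uniformAlgebraicityAtCMPoints_of_forall_cmSpreadingAt)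
open Summit.HodgeConjecture.HodgeConjecture.Ring2.Hypotheses (UniformAlgebraicityOn
  uniformAlgebraicityOn_of_uniformAlgebraicityAtCMPoints)
open Summit.HodgeConjecture.HodgeConjecture.Theorems.HodgeAbelianVarieties.Negative (iff_hodgeConjecture_restricted)

variable {𝒳 S : SchemeOver ℂ}

/-! ## §A U_∃ — CM-spreading along SOME CM-dense Mumford–Tate family, per Hodge class -/

/-- **CM-SPREADING ALONG SOME CM-DENSE MUMFORD–TATE FAMILY, PER HODGE CLASS** (U_∃). For every complex abelian
variety `A` (smooth projective of dimension `dim A`), every `p` and every rational class `c` of Hodge type `(p,p)` on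
`A`, there is a family `f : 𝒳 ⟶ S` which is a CM-dense Mumford–Tate family for `(A, p, c)` in the sense of
Charles–Schnell Thm. 11.5.11 (a)–(c) / Deligne Prop. 6.1 (`Deligne1982.IsCMDenseMumfordTateFamilyFor A p c f`: smooth
projective of relative dimension `dim A` over a smooth irreducible quasi-projective base, abelian charts at every
fibre, a fibrewise rational `(p,p)` global class `W` with `e^*(W|_{𝒳_{s₁}}) = c` along `e : A.X ≅ 𝒳_{s₁}`, CM locus
DENSE) along which algebraicity spreads from the CM fibres to every fibre: `Ring2.Deform.CMSpreadingTo f (dim A) s₁`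
for all `s₁` (deform VII: every fibrewise rational `(p,p)` global class algebraic at all CM fibres of `f` is algebraic
at `s₁`). Row U (`UniformAlgebraicityAtCMPoints`, ALL admissible CM-dense families) restricted to SOME printed family
per class — the Mumford–Tate twin of deform XIII's CPS_∃ (`CMAnchoredPencilCMSpreading`). Implied by U and by `HC_AV`
granted Deligne's family fact (§A below); with `HC_CM` it gives `HC_AV` with NO named fact. OPEN; no print locator of
its own (the printed Principle B transports absolute-Hodge-ness, not algebraicity); a HYPOTHESIS wherever used; never
asserted. [cite: CharlesSchnell2014Notes, Thm. 11.5.11 (a)–(c) (p. 516), Conj. 11.3.1 and Prop. 11.3.11]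
[cite: Deligne1982HodgeCycles, Prop. 6.1 (p. 71), Thm. 2.12 and Prop. 2.9] [status: open] -/
@[conjecture] def CMDenseFamilyCMSpreading : Prop :=
  ∀ (A : AbelianVariety ℂ), IsSmoothProjective A.dim A.X →
    ∀ (p : ℕ) (c : complexBetti A.X (2 * p)), IsRationalClass c → IsOfHodgeType A.dim A.X (2 * p) p p c →
      ∃ (𝒳 S : SchemeOver ℂ) (f : 𝒳 ⟶ S), IsCMDenseMumfordTateFamilyFor A p c f ∧
        ∀ s₁ : ComplexPoints S, CMSpreadingTo f A.dim s₁

/-- **`HC_CM ∧ U_∃ ⟹` Hodge for every complex abelian variety — NO named fact** (variety by variety). Given a rational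
`(p,p)` class `c` on `A`, take the U_∃ family through `(A, c)`; `HC_CM` makes its global class `W` algebraic at EVERY
CM fibre (`Ring2.Deform.forall_cmLocus_mem_algebraicClasses_of_HC_CM` — the only use of `hCM`); CM-spreading concludes
at the fibre `s₁` carrying `A`; transport back along `e : A.X ≅ 𝒳_{s₁}`. [cite: Deligne1982HodgeCycles, §6 proof of
Thm. 2.11 (pp. 71–73)] [cite: CharlesSchnell2014Notes, Thm. 11.5.11 and its proof] -/
theorem hodgeConjecture_abelian_of_HC_CM_of_cmDenseFamilyCMSpreading (hCM : CMAbelianHodge)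
    (h : CMDenseFamilyCMSpreading) :
    ∀ A : AbelianVariety ℂ, IsSmoothProjective A.dim A.X → HodgeConjectureFor A.dim A.X := by
  intro A hA
  refine (hodgeConjectureFor_iff_of_isSmoothProjective nonempty_hodgeModel_holds hA).2 ?_
  intro p c hc hpp
  obtain ⟨𝒳, S, f, ⟨s₁, e, W, _, _, _, _, _, _, hW, hWc, _⟩, hsp⟩ := h A hA p c hc hpp
  rw [← hWc]
  exact (mem_algebraicClasses_map_iff_of_iso e).2
    (hsp s₁ p W hW (forall_cmLocus_mem_algebraicClasses_of_HC_CM hCM f W hW))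

/-- **`HC_AV_of_HC_CM_and_cmDenseFamilyCMSpreading` — the brief's `HC_AV_of_HC_CM_and_Bmin` on the Mumford–Tate branch
with `B_min = U_∃` and EXACTLY two hypotheses** (no `hF`): `HC_CM → U_∃ → HC_AV`. [cite: Deligne1982HodgeCycles, Prop. 6.1]
[cite: CharlesSchnell2014Notes, Thm. 11.5.11] -/
theorem HC_AV_of_HC_CM_and_cmDenseFamilyCMSpreading (hCM : CMAbelianHodge) (h : CMDenseFamilyCMSpreading) :
    HodgeAbelianVarieties :=
  iff_hodgeConjecture_restricted.2 (hodgeConjecture_abelian_of_HC_CM_of_cmDenseFamilyCMSpreading hCM h)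

/-- U_∃ closes with `HC_CM`, NO fact (LEAD grammar). [cite: CharlesSchnell2014Notes, Thm. 11.5.11] -/
theorem closesWithCM_cmDenseFamilyCMSpreading : ClosesWithCM CMDenseFamilyCMSpreading :=
  fun hCM h ↦ HC_AV_of_HC_CM_and_cmDenseFamilyCMSpreading hCM h

/-- Hence `U_∃ ⟹ CMToAbelian` outright (a typed conditional toward stmt-HodgeConjecture-16267, which stays OPEN). [folklore] -/
theorem cmToAbelian_of_cmDenseFamilyCMSpreading (h : CMDenseFamilyCMSpreading) : CMToAbelian :=
  cmToAbelian_of_closesWithCM closesWithCM_cmDenseFamilyCMSpreading h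

/-- **`U ⟹ U_∃` granted Deligne's family fact**: row U holds on the printed CM-dense family through `(A, c)`, and
over a dense CM locus row U on a family is CM-spreading to every fibre (deform VII `cmSpreadingTo_of_uniformAlgebraicityOn`).
[cite: Deligne1982HodgeCycles, Prop. 6.1] [cite: CharlesSchnell2014Notes, Thm. 11.5.11 and Prop. 11.3.11] -/
theorem cmDenseFamilyCMSpreading_of_deligne1982_of_uniform (hF : deligne1982_cmDenseMumfordTateFamilies)
    (hU : UniformAlgebraicityAtCMPoints) : CMDenseFamilyCMSpreading := by
  intro A hA p c hc hpp
  obtain ⟨𝒳, S, f, hfam⟩ := hF A hA p c hc hpp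
  refine ⟨𝒳, S, f, hfam, ?_⟩
  obtain ⟨_, _, _, hf, h𝒳, hS, hirr, hsm, hab, _, _, hD⟩ := hfam
  exact cmSpreadingTo_of_uniformAlgebraicityOn hD
    (uniformAlgebraicityOn_of_uniformAlgebraicityAtCMPoints hU hf h𝒳 hS hirr hsm hab hD)

/-- `(∀ A, CMSpreadingAt A) ⟹ U_∃` granted the family fact (through deform VII's "row U is local in the variety").
[cite: CharlesSchnell2014Notes, Prop. 11.3.11] -/
theorem cmDenseFamilyCMSpreading_of_deligne1982_of_forall_cmSpreadingAt (hF : deligne1982_cmDenseMumfordTateFamilies)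
    (h : ∀ A : AbelianVariety ℂ, CMSpreadingAt A) : CMDenseFamilyCMSpreading :=
  cmDenseFamilyCMSpreading_of_deligne1982_of_uniform hF (uniformAlgebraicityAtCMPoints_of_forall_cmSpreadingAt h)

/-- ON-PATH granted the family fact: `HC_AV ⟹ U_∃`. [cite: CharlesSchnell2014Notes, Cor. 11.3.6 (p. 494) and Thm. 11.5.11] -/
theorem cmDenseFamilyCMSpreading_of_deligne1982_of_HC_AV (hF : deligne1982_cmDenseMumfordTateFamilies)
    (h : HodgeAbelianVarieties) : CMDenseFamilyCMSpreading :=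
  cmDenseFamilyCMSpreading_of_deligne1982_of_uniform hF (Deform.uniformAlgebraicityAtCMPoints_of_HC_AV h)

/-- ON-PATH granted the family fact: `HodgeConjecture ⟹ U_∃`. [folklore] -/
theorem cmDenseFamilyCMSpreading_of_deligne1982_of_hodgeConjecture (hF : deligne1982_cmDenseMumfordTateFamilies)
    (h : _root_.HodgeConjecture) : CMDenseFamilyCMSpreading :=
  cmDenseFamilyCMSpreading_of_deligne1982_of_HC_AV hF (Deform.HC_AV_of_hodgeConjecture h)

/-- `OnPathAV U_∃` mod `hF` (LEAD grammar). [cite: CharlesSchnell2014Notes, Cor. 11.3.6] -/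
theorem onPathAV_cmDenseFamilyCMSpreading (hF : deligne1982_cmDenseMumfordTateFamilies) :
    OnPathAV CMDenseFamilyCMSpreading :=
  cmDenseFamilyCMSpreading_of_deligne1982_of_HC_AV hF

/-- **EXACTNESS: `HC_AV ↔ HC_CM ∧ U_∃`, granted the family fact** — both factors genuine in the kernel; in print
`HC_CM` is NOT known to follow from U_∃ (KIND 2). The fact sits on the on-path side only. [cite: CharlesSchnell2014Notes,
Cor. 11.3.6 and Thm. 11.5.11] [cite: Deligne1982HodgeCycles, Prop. 6.1] -/
theorem exactWithCM_cmDenseFamilyCMSpreading (hF : deligne1982_cmDenseMumfordTateFamilies) :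
    ExactWithCM CMDenseFamilyCMSpreading :=
  exactWithCM_iff.2 ⟨closesWithCM_cmDenseFamilyCMSpreading, onPathAV_cmDenseFamilyCMSpreading hF⟩

/-- The same, unfolded: `HC_AV ↔ (HC_CM ∧ U_∃)` mod `hF`. [cite: CharlesSchnell2014Notes, Thm. 11.5.11] -/
theorem HC_AV_iff_HC_CM_and_cmDenseFamilyCMSpreading (hF : deligne1982_cmDenseMumfordTateFamilies) :
    HodgeAbelianVarieties ↔ (CMAbelianHodge ∧ CMDenseFamilyCMSpreading) :=
  exactWithCM_cmDenseFamilyCMSpreading hF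

/-- Relativised to `HC_CM`, U_∃ IS the item: `ModCM U_∃ ↔ CMToAbelian`, mod `hF`. [folklore] -/
theorem modCM_cmDenseFamilyCMSpreading_iff_cmToAbelian (hF : deligne1982_cmDenseMumfordTateFamilies) :
    ModCM CMDenseFamilyCMSpreading ↔ CMToAbelian :=
  modCM_iff_cmToAbelian_of_exactWithCM (exactWithCM_cmDenseFamilyCMSpreading hF)

/-- **The bottom of the Mumford–Tate branch**: `U ⟹[hF] U_∃ ⟹ CMToAbelian` (the last arrow fact-free), extending part II
of the frame's `(1) ⟹ S_ZD ⟹ U_Z ⟹ U`. [cite: CharlesSchnell2014Notes, Thm. 11.5.11] -/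
theorem ladder_mtBranch_bottom (hF : deligne1982_cmDenseMumfordTateFamilies) :
    (UniformAlgebraicityAtCMPoints → CMDenseFamilyCMSpreading) ∧ (CMDenseFamilyCMSpreading → CMToAbelian) :=
  ⟨cmDenseFamilyCMSpreading_of_deligne1982_of_uniform hF, cmToAbelian_of_cmDenseFamilyCMSpreading⟩

/-- **Both per-class bottoms close fact-free**: CPS_∃ (pencil branch, deform XIII) and U_∃ (Mumford–Tate branch).
[cite: Andre1996Motifs, §6.3 a) (p. 33)] [cite: CharlesSchnell2014Notes, Thm. 11.5.11] -/
theorem closesWithCM_perClassBottoms :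
    ClosesWithCM CMAnchoredPencilCMSpreading ∧ ClosesWithCM CMDenseFamilyCMSpreading :=
  ⟨closesWithCM_cmAnchoredPencilCMSpreading, closesWithCM_cmDenseFamilyCMSpreading⟩

/-- Even the disjunction of the two per-class bottoms closes with `HC_CM` and no fact. [folklore] -/
theorem closesWithCM_perClassBottoms_or :
    ClosesWithCM (CMAnchoredPencilCMSpreading ∨ CMDenseFamilyCMSpreading) :=
  fun hCM h ↦ h.elim (closesWithCM_cmAnchoredPencilCMSpreading hCM) (closesWithCM_cmDenseFamilyCMSpreading hCM)

/-- **Cross-branch, bottom tier**: under `HC_CM`, granted Lemme 6.3.1 and the family fact, `U_∃ ↔ CPS_∃` and `U_∃ ↔ U`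
(all are `HC_AV`). WITHOUT `HC_CM` no implication between U_∃ and CPS_∃ is in the tree, in either direction, and none
is claimed. [cite: Andre1996Motifs, Lemme 6.3.1 and Remarque 2 (pp. 31–33)] [cite: Deligne1982HodgeCycles, Prop. 6.1] -/
theorem perClassBottoms_collapse_of_HC_CM (h₂₁ : andre1996_cmAnchoredPencil)
    (hF : deligne1982_cmDenseMumfordTateFamilies) (hCM : CMAbelianHodge) :
    (CMDenseFamilyCMSpreading ↔ CMAnchoredPencilCMSpreading) ∧
      (CMDenseFamilyCMSpreading ↔ UniformAlgebraicityAtCMPoints) :=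
  ⟨iff_of_exactWithCM_of_HC_CM (exactWithCM_cmDenseFamilyCMSpreading hF) (exactWithCM_cmSpreading_of_andre1996 h₂₁).1 hCM,
    iff_of_exactWithCM_of_HC_CM (exactWithCM_cmDenseFamilyCMSpreading hF) (exactWithCM_spreadAxis hF).2.2 hCM⟩

/-- Relativised, without `HC_CM` as a hypothesis: `ModCM U_∃ ↔ ModCM CPS_∃` mod `h₂₁ ∧ hF` (both are the item). [folklore] -/
theorem modCM_cmDenseFamilyCMSpreading_iff_modCM_cmAnchoredPencilCMSpreading (h₂₁ : andre1996_cmAnchoredPencil)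
    (hF : deligne1982_cmDenseMumfordTateFamilies) :
    ModCM CMDenseFamilyCMSpreading ↔ ModCM CMAnchoredPencilCMSpreading :=
  (modCM_cmDenseFamilyCMSpreading_iff_cmToAbelian hF).trans (modCM_cmAnchoredPencilCMSpreading_iff_cmToAbelian h₂₁).symm

/-- Class axis: under `HC_CM`, U_∃ closes EVERY class target `HCOnClass 𝒞` of typer 1's atlas axis, fact-free.
[cite: CharlesSchnell2014Notes, Thm. 11.5.11] -/
theorem hcOnClass_of_HC_CM_of_cmDenseFamilyCMSpreading (hCM : CMAbelianHodge) (h : CMDenseFamilyCMSpreading)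
    (𝒞 : AbelianVariety ℂ → Prop) : ClassTargets.HCOnClass 𝒞 :=
  hcOnClass_of_closesWithCM closesWithCM_cmDenseFamilyCMSpreading hCM h 𝒞

#print axioms Summit.HodgeConjecture.HodgeConjecture.Ring2.AbelianAll.HC_AV_of_HC_CM_and_cmDenseFamilyCMSpreading
#print axioms Summit.HodgeConjecture.HodgeConjecture.Ring2.AbelianAll.exactWithCM_cmDenseFamilyCMSpreading

end Summit.HodgeConjecture.HodgeConjecture.Ring2.AbelianAll

end
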